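import Summits.HodgeConjecture.HodgeConjecture.Theses.PeriodsPolice
import Literature.AlgebraicGeometry.Motives.PeriodRealizationClassicalCore

/-!
# Birth skeleton of piece P1 `ClassicalPeriodRealization` :
`∃ P : PeriodRealization ℚ̄, P.IsClassicalCore ∧ HodgeRiemannIIStatement P.B ∧ P.B.W.HasProdHyperplaneClasses`

The PARITY seam (the one typed seam of the construction that survives the twist analysis): the
sign of the complexified Lefschetz form of a Betti–Hodge datum relative to the genuine one is
`μ · qʳ` (`μ` = trace scalar, `q` = hyperplane scalar, `r = n - i`), and the Weil axiom
`tr(ηⁿ) > 0` forces `μ qⁿ > 0`; hence Hodge–Riemann II in EVEN degree `i` is twist-invariant — a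
theorem for every pinned datum — while in ODD degree it pins the sign of `q` and must be delivered by
the construction.  Two stubs and the kernel-checked composition `ClassicalPeriodRealization_of`:
* `stub_core_prodHyp_oddHRII` — the classical construction (Betti Weil cohomology with genuine Hodge
  structures and supported cycle classes, algebraic de Rham over `ℚ̄`, Grothendieck comparison) with
  product hyperplane classes and Hodge–Riemann II in odd degrees;
* `stub_evenHRII` — Hodge–Riemann II in even degrees for EVERY pinned Betti–Hodge datum
  (Voisin I Thm. 6.32 (ii) + the sign bookkeeping above).
-/

set_option linter.dupNamespace false

namespace Summit.HodgeConjecture.HodgeConjecture.Cruxes.ClassicalBridge.PiecesSplit.P1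

open scoped TensorProduct
open Literature.AlgebraicGeometry.Motives Literature.AlgebraicGeometry.HodgeTheory

/-- Stub 1 (construction, odd-degree positivity): a classical-core period realization over `ℚ̄` with
product hyperplane classes and Hodge–Riemann II in odd degrees. [Grothendieck1966 Thm 1';
Deligne1982 §1; VoisinHodgeI2002 Thm. 6.32 (ii); Kleiman1968 §1.2, §1.4] -/
theorem stub_core_prodHyp_oddHRII :
    ∃ P : PeriodRealization (AlgebraicClosure ℚ), P.IsClassicalCore ∧ P.B.W.HasProdHyperplaneClasses ∧
      ∀ ⦃n : ℕ⦄ ⦃X : SchemeOver ℂ⦄ (hX : IsSmoothProjective n X) ⦃η : P.B.W.obj X 2⦄,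
        P.B.W.IsHyperplaneClass X η → ∀ ⦃i r j : ℕ⦄ (hr : i + r = n) (hj : i + 2 * r = j), Odd i →
          ∀ ⦃p q : ℤ⦄, p + q = i → ∀ ⦃x : ℂ ⊗[ℚ] P.B.W.obj X i⦄, x ∈ (P.B.hodge hX i).piece p q → x ≠ 0 →
            x ∈ (P.B.W.primitivePart X η i (r + 1) (j + 2) (by omega)).baseChange ℂ →
              ∃ t : ℝ, 0 < t ∧
                Complex.I ^ p * (Complex.I ^ q)⁻¹ * (-1 : ℂ) ^ (i.choose 2) *
                  (P.B.W.lefschetzForm X (n := n) η i r j hj (by omega)).baseChange ℂ x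
                    (HodgeStructure.conj x) = t := by
  sorry

/-- Stub 2 (even-degree Hodge–Riemann II is twist-invariant): for EVERY pinned Betti–Hodge datum,
Hodge–Riemann II holds in even degrees. [VoisinHodgeI2002 Thm. 6.32 (ii); Kleiman1968 §1.2 (C)
`tr(ηⁿ) > 0`] -/
theorem stub_evenHRII :
    ∀ (B : BettiHodgeData ℂ), B.IsClassicalHodge →
      ∀ ⦃n : ℕ⦄ ⦃X : SchemeOver ℂ⦄ (hX : IsSmoothProjective n X) ⦃η : B.W.obj X 2⦄,
        B.W.IsHyperplaneClass X η → ∀ ⦃i r j : ℕ⦄ (hr : i + r = n) (hj : i + 2 * r = j), Even i →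
          ∀ ⦃p q : ℤ⦄, p + q = i → ∀ ⦃x : ℂ ⊗[ℚ] B.W.obj X i⦄, x ∈ (B.hodge hX i).piece p q → x ≠ 0 →
            x ∈ (B.W.primitivePart X η i (r + 1) (j + 2) (by omega)).baseChange ℂ →
              ∃ t : ℝ, 0 < t ∧
                Complex.I ^ p * (Complex.I ^ q)⁻¹ * (-1 : ℂ) ^ (i.choose 2) *
                  (B.W.lefschetzForm X (n := n) η i r j hj (by omega)).baseChange ℂ x
                    (HodgeStructure.conj x) = t := by
  sorry

/-- Composition: the two stubs give P1 (parity case split on the degree). -/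
theorem ClassicalPeriodRealization_of
    (h₁ : ∃ P : PeriodRealization (AlgebraicClosure ℚ), P.IsClassicalCore ∧ P.B.W.HasProdHyperplaneClasses ∧
      ∀ ⦃n : ℕ⦄ ⦃X : SchemeOver ℂ⦄ (hX : IsSmoothProjective n X) ⦃η : P.B.W.obj X 2⦄,
        P.B.W.IsHyperplaneClass X η → ∀ ⦃i r j : ℕ⦄ (hr : i + r = n) (hj : i + 2 * r = j), Odd i →
          ∀ ⦃p q : ℤ⦄, p + q = i → ∀ ⦃x : ℂ ⊗[ℚ] P.B.W.obj X i⦄, x ∈ (P.B.hodge hX i).piece p q → x ≠ 0 →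
            x ∈ (P.B.W.primitivePart X η i (r + 1) (j + 2) (by omega)).baseChange ℂ →
              ∃ t : ℝ, 0 < t ∧
                Complex.I ^ p * (Complex.I ^ q)⁻¹ * (-1 : ℂ) ^ (i.choose 2) *
                  (P.B.W.lefschetzForm X (n := n) η i r j hj (by omega)).baseChange ℂ x
                    (HodgeStructure.conj x) = t)
    (h₂ : ∀ (B : BettiHodgeData ℂ), B.IsClassicalHodge →
      ∀ ⦃n : ℕ⦄ ⦃X : SchemeOver ℂ⦄ (hX : IsSmoothProjective n X) ⦃η : B.W.obj X 2⦄,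
        B.W.IsHyperplaneClass X η → ∀ ⦃i r j : ℕ⦄ (hr : i + r = n) (hj : i + 2 * r = j), Even i →
          ∀ ⦃p q : ℤ⦄, p + q = i → ∀ ⦃x : ℂ ⊗[ℚ] B.W.obj X i⦄, x ∈ (B.hodge hX i).piece p q → x ≠ 0 →
            x ∈ (B.W.primitivePart X η i (r + 1) (j + 2) (by omega)).baseChange ℂ →
              ∃ t : ℝ, 0 < t ∧
                Complex.I ^ p * (Complex.I ^ q)⁻¹ * (-1 : ℂ) ^ (i.choose 2) *
                  (B.W.lefschetzForm X (n := n) η i r j hj (by omega)).baseChange ℂ x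
                    (HodgeStructure.conj x) = t) :
    ∃ P : PeriodRealization (AlgebraicClosure ℚ), P.IsClassicalCore ∧ HodgeRiemannIIStatement P.B ∧
      P.B.W.HasProdHyperplaneClasses := by
  obtain ⟨P, hcore, hprod, hodd⟩ := h₁
  refine ⟨P, hcore, ?_, hprod⟩
  intro n X hX η hη i r j hr hj p q hpq x hx hx0 hprim
  rcases Nat.even_or_odd i with hi | hi
  · exact h₂ P.B hcore.isClassicalHodge hX hη hr hj hi hpq hx hx0 hprim
  · exact hodd hX hη hr hj hi hpq hx hx0 hprim

/-- P1 from the stubs. -/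
theorem classicalPeriodRealization :
    ∃ P : PeriodRealization (AlgebraicClosure ℚ), P.IsClassicalCore ∧ HodgeRiemannIIStatement P.B ∧
      P.B.W.HasProdHyperplaneClasses :=
  ClassicalPeriodRealization_of stub_core_prodHyp_oddHRII stub_evenHRII

end Summit.HodgeConjecture.HodgeConjecture.Cruxes.ClassicalBridge.PiecesSplit.P1
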